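import Summits.RiemannHypothesis.RiemannHypothesis.Theorems.SemilocalNegCert
import HarnessLib

/-!
# Semi-local threshold, negative side — CALIBRATION of the `WeilNegCert2` format on lad-2's rung `a*({2}) ≤ 0.57`

Cell `rh-explicit`, seat cc-s2-4 (`HOME/cc-s2-4/CC4-LEAN.md` §5; LEAD RULING R4-5: the calibration row of the generic format).
The degree-11 odd witness of `MotivicDoorSemilocalUndecicWitness.lean` (`pU(x/b)`, `b = 57/100`), written in powers of `x`, re-certified
by the NEW format: the 1,344-line / 6-file cell proof of generation 5 becomes one `decide` (≈ 10 s of kernel time).  The five terms of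
the criterion, as the checker bounds them (exact rationals, printed to 16 digits; seat file `work/py/cert.py`), against lad-2's
cell bounds and moll-step0-2's certified TRUE values: `(log 2/√2)·D(log 2) ≤ 671620.5227165956` (upper bound BY THEOREM
`ev_le_evalUpperQ` + `log 2/√2 ≤ logTwoHi20/sqrtTwoLo`; the certified true value is `671620.5227166` to 7 decimals — consistent;
lad-2's cells gave `671631.44`); `∫₀^{2b} w·D ≤ 2513582.458755470` (true `2513582.45876…`; cells `2516764.99`);
`∫_{2b}^∞ w·D ≤ 1810821.158942096` (cells `1810897.57`); `2|Ĝ(1)|² ≥ 31737.66386874986` (cells `31736.88`); `C₂‖G‖² ≥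
c2SharpQ·N = 4977107.72…` (`N = ‖G‖² = 783495.2396973461`).  Checked inequality: `lhsQ = 4996024.140414162 < rhsQ =
5008845.388695236`, margin `0.01636·‖G‖²` (cells + coarse constant: `0.0109·‖G‖²`).  The conclusion `a*({2}) ≤ 57/100` is
already the tree's `weilSemilocalThreshold_two_le`; this file is the format's regression test, not a new bound.
-/

set_option linter.dupNamespace false

namespace Summit.RiemannHypothesis.RiemannHypothesis.Theorems.SemilocalPolyWitness

/-- lad-2's undecic witness in powers of `x`: `p(x) = Σ c_k (x/b)^k`, `b = 57/100`. -/
def p057 : List ℚ :=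
  [0, -48200/57, 0, -18275000000/185193, 0, 155120000000000/66854673, 0, -9981400000000000000/651632497731, 0,
    267410000000000000000000/6351461955384057, 0, -15470000000000000000000000/362033331456891249]

/-- The calibration certificate: `b = 57/100`, orders `(nA, mA, KA, Kt, nt, ne) = (14, 7, 5, 10, 40, 16)`. -/
def cert057 : WeilNegCert2 := ⟨p057, 57 / 100, 14, 7, 5, 10, 40, 16⟩

set_option maxHeartbeats 0 in
/-- The checker accepts `cert057` against the sharp constant `c2SharpQ`. -/
theorem check_cert057 : cert057.check c2SharpQ = true := by
  decide +kernel

/-- **Calibration**: `a*({2}) ≤ 0.57` by the new format (= `weilSemilocalThreshold_two_le` of lad-2). -/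
theorem weilSemilocalThreshold_two_le_057 :
    MotivicDoor.SemilocalThreshold.weilSemilocalThreshold {2} ≤ ((57 / 100 : ℚ) : ℝ) :=
  weilSemilocalThreshold_two_le_of_check_sharp cert057 check_cert057

end Summit.RiemannHypothesis.RiemannHypothesis.Theorems.SemilocalPolyWitness
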